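import Literature.NumberTheory.EllipticCurves.RootNumberProofs
import Literature.NumberTheory.DiophantineGeometry.MinimalDiscriminantSmulProofs
import HarnessLib

/-!
# Local root numbers — invariance under changes of variables (proof)

Sibling proof file of `Literature.NumberTheory.EllipticCurves.RootNumber` (D-0014: the statement
file keeps the named fact `def … : Prop`; its discharge lives here, sorry-free, in its own file so
that concurrent discharges of the topic do not overwrite each other). This file discharges

* `WeierstrassCurve.localRootNumber_smul` by `WeierstrassCurve.localRootNumber_smul_holds`: for an
  elliptic `W` over the fraction field `K` of a DVR `R` and every change of variables `C` over `K`,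
  `(C • W).localRootNumber R = W.localRootNumber R`.

`WeierstrassCurve.localRootNumber R X` (Rohrlich's case list) is a function of the reduction type
(good / multiplicative / split multiplicative), of `ord (Δ)`, `ord (c₄)` of the integral model of
Mathlib's chosen minimal model `X.minimal R`, and of the residue field. The chosen minimal models of
`W` and of `C • W` are two `K`-isomorphic minimal equations of the same elliptic curve, so these data
agree (Silverman, AEC VII.1, Prop. 1.3(b), PDF pp. 165–166: the relating change of variables has
`u ∈ R*`, `r, s, t ∈ R`; VII.2, PDF p. 166; VII.5, Definition and Prop. 5.1, PDF p. 174):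
`hasGoodReduction_iff_of_isMinimal_of_eq_smul` (file `RootNumberProofs`),
`hasMultiplicativeReduction_iff_of_isMinimal_of_eq_smul`,
`hasSplitMultiplicativeReduction_iff_of_isMinimal_of_eq_smul`,
`valuation_Δ_eq_of_isMinimal_of_eq_smul`, `valuation_c₄_eq_of_isMinimal_of_eq_smul` (file
`LocalReductionProofs`), the last two turned into equalities of `addVal` of the integral models by
`IsDiscreteValuationRing.addVal_eq_addVal_of_valuation_algebraMap_eq` (file
`MinimalDiscriminantSmulProofs`).

## References

* J. H. Silverman, *The Arithmetic of Elliptic Curves*, GTM 106, 2nd ed. 2009, §VII.1, Prop. 1.3(b)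
  (PDF pp. 165–166), §VII.2 (PDF p. 166) and §VII.5, Definition and Prop. 5.1 (PDF p. 174).
* D. Rohrlich, *Elliptic curves and the Weil–Deligne group*, CRM Proc. Lecture Notes 4 (1994), §19.
-/

namespace WeierstrassCurve

open IsDiscreteValuationRing

variable (R : Type*) [CommRing R] [IsDomain R] [IsDiscreteValuationRing R]
  {K : Type*} [Field K] [Algebra R K] [IsFractionRing R K] (W : WeierstrassCurve K)

/-- **Discharge** of the named fact `WeierstrassCurve.localRootNumber_smul`: the local root number
of an *elliptic* `W / K` (Rohrlich's case list on Mathlib's chosen minimal model) is unchanged under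
any change of variables `C` over `K`. The chosen minimal models `M` of `W` and `M'` of `C • W` are
`K`-isomorphic minimal equations of an elliptic curve, hence differ by `⟨u, r, s, t⟩` with `u ∈ R*`,
`r, s, t ∈ R` (Silverman, AEC VII.1, Prop. 1.3(b)); so their reduction types (VII.5, Definition and
Prop. 5.1: good / multiplicative / split multiplicative) and `ord (Δ)`, `ord (c₄)` of their integral
models agree, and the case list takes the same value (the residue-field data `#k`, `char k` are
literally the same). Rohrlich, CRM Proc. 4 (1994), §19 (`W(E/K)` is attached to `E / K`).
[cite: SilvermanAEC2009, VII.1 Prop. 1.3(b) (PDF pp. 165–166) and VII.5 Prop. 5.1 (PDF p. 174)]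
[cite: Rohrlich1994CRM, §19] -/
theorem localRootNumber_smul_holds : W.localRootNumber_smul R := by
  intro _ C
  classical
  obtain ⟨D₁, hD₁⟩ : ∃ D : VariableChange K, W.minimal R = D • W := ⟨_, rfl⟩
  obtain ⟨D₂, hD₂⟩ : ∃ D : VariableChange K, (C • W).minimal R = D • (C • W) := ⟨_, rfl⟩
  haveI : (W.minimal R).IsElliptic := by rw [hD₁]; infer_instance
  have hΔ : (W.minimal R).Δ ≠ 0 := (W.minimal R).isUnit_Δ.ne_zero
  have hrel : (C • W).minimal R = (D₂ * C * D₁⁻¹) • W.minimal R := by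
    rw [hD₂, hD₁, mul_smul, mul_smul, inv_smul_smul]
  -- `ord (Δ)` and `ord (c₄)` of the two integral models agree
  have hvΔ : addVal R (((C • W).minimal R).integralModel R).Δ =
      addVal R ((W.minimal R).integralModel R).Δ := by
    apply addVal_eq_addVal_of_valuation_algebraMap_eq R (L := K)
    rw [integralModel_Δ_eq, integralModel_Δ_eq]
    exact valuation_Δ_eq_of_isMinimal_of_eq_smul R hrel
  have hvc₄ : addVal R (((C • W).minimal R).integralModel R).c₄ =
      addVal R ((W.minimal R).integralModel R).c₄ := by
    apply addVal_eq_addVal_of_valuation_algebraMap_eq R (L := K)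
    rw [integralModel_c₄_eq, integralModel_c₄_eq]
    exact valuation_c₄_eq_of_isMinimal_of_eq_smul R hrel hΔ
  simp only [localRootNumber, hasGoodReduction_iff_of_isMinimal_of_eq_smul R hrel,
    hasMultiplicativeReduction_iff_of_isMinimal_of_eq_smul R hrel hΔ,
    hasSplitMultiplicativeReduction_iff_of_isMinimal_of_eq_smul R hrel hΔ, hvΔ, hvc₄]

end WeierstrassCurve
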